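import Literature.NumberTheory.EllipticCurves.Kato2004.IwasawaCohomologyExistsProofs
import Literature.NumberTheory.EllipticCurves.Kato2004.EllipticZetaReciprocity
import Literature.NumberTheory.GaloisRepresentations.AbsGaloisGroupCompact
import HarnessLib

/-!
# Kato 2004 (Astérisque 295) §8.2 / Lemma 8.5 and §12.2 over a NUMBER FIELD `K`: the Iwasawa cohomology
# `𝐇¹_{K,Γ}(T_pE) = H¹_Iw(K_Σ/K, T_pE) = lim←_n H¹(O_{K_n}[1/p], T_pE)` along a `ℤ_p`-extension `K_∞/K`, as a
# PINNED `Λ`-module interface (`IwasawaH1DataOver`) — the `K`-analogue of `Kato2004.IwasawaH1Data` — with its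
# EXISTENCE and the rigidity of the pin PROVED (definitions + theorems; no named fact)

Topic `NumberTheory/EllipticCurves`, sub-directory `Kato2004` (namespace = path).  Seat `bsd-2adic-conv-1` GEN 29
(cell `pub/bsd-2adic`), WANTED-CARRIER-K of the pen's RC-366 (2) / RC-369 (crux `OrdLambdaHalfAtTwo` = item
stmt-BirchSwinnertonDyer-19556, line `kato_determinant_greenberg_two`, stub 4″): the `K`-level global Iwasawa
cohomology over which the Poitou–Tate sequence over `K_∞` ([Greenberg 2006], [Greenberg 2010/11 Prop 3.1.1]) and the
Shapiro maps to the `ℚ`-side carriers are to be STATED (t1 facts / t2 kernel lemmas), so that the memo-tier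
binders `TwoAdicShapiroPT.{LambdaShapiroFineAtTwo, ShapiroLatticePoitouTateAtTwo}` can be retired.
HONEST FRAMING: VOCABULARY ONLY — a hypothesis structure, its unfolding API, and two PROVED structural theorems
(existence of the datum; rigidity of the pin); no arithmetic content, nothing about any curve is asserted; BSD is
not advanced by this file.

## The printed statements (K. Kato, Astérisque 295 (2004); store `paper:doi-10-24033-ast-639`, PDF page = printed − 115)

* **§8.2 [pp. 180–181]**, for a GENERAL field of fractions `K` of an integral domain `R`: "`H^q(R, T) =
  lim←_n H^q(R, T/p^n)`" for "a finitely generated `ℤ_p`-module `T` endowed with a continuous action of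
  `Gal(K̄/K)` which is unramified at almost all finite places of `K`"; **Lemma 8.5 (1) [pp. 183–184]** "For any
  set `S` of finite places of `K` containing all places lying over `p`, the canonical map `H¹(O_K[S⁻¹], T) →
  H¹(K, T)` is injective", with `H¹(O_v, T) = H¹(Gal(K_v^{ur}/K_v), H⁰(K_v^{ur}, T))` in the proof [p. 184].
  READING (as in `IwasawaCohomology.lean`, = clause (C2) of `Kato2004.ZetaBody`): the image of
  `H¹(O_F[1/p], T) ↪ H¹(F, T)` is the set of classes whose restriction to EVERY inertia group `I_𝔓 ∩ Gal(K̄/F)`,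
  `𝔓 ∤ p`, vanishes — over `K` this is the tree's `CM.integralH1K` (`EllipticZetaReciprocity.lean`: `v` a finite place of `K` with `p ∉ v`, `𝔓` a
  prime of `\bar ℤ_K` above `v`, `I_𝔓 ≤ Γ_K` Mathlib's `Ideal.inertia`), REUSED here.
* **§12.2 [p. 220]** (over `ℚ`): "`𝐇^q(T) = lim←_n H^q(ℤ[ζ_{p^n}, 1/p], T)` … the inverse limit is taken with
  respect to trace maps … (12.2.1) `𝐇¹(T)` and `𝐇²(T)` are finitely generated `ℤ_p[[G_∞]]`-modules".  Over a
  number field `K` and a `ℤ_p`-extension `K_∞ = ⋃ K_n` the same object `lim←_n H¹(O_{K_n}[1/p], T)` with its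
  `Λ = ℤ_p⟦Gal(K_∞/K)⟧`-structure is the Iwasawa cohomology `H¹_Iw(K_Σ/K_∞, T)` = `H¹_∞(K, T)` of Perrin-Riou
  [PerrinRiou1994Invent, §1] and Rubin [Rubin2000, App. B §2–§3] (Kato's [Ru4]); this file only TYPES it.
  -- TODO(general form): arbitrary `p`-adic representations `T` of `Γ_K` (here `T = T_pE` of an elliptic curve
  -- over `K`); `𝐇²`; the `Λ`-module structure over the full `ℤ_p[[Gal(K(μ_{p^∞})/K)]]`.

## What is here (mirror image, word for word, of `Kato2004/IwasawaCohomology.lean` + `…ExistsProofs` + `…UniqueProofs` with `ℚ ↦ K`)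

* §1 `conjMap_mem_integralH1K`: the `Γ_K`-action preserves the integral classes `CM.integralH1K T p U ≤ H¹(U, T)` (the tree's
  `K`-version of Kato's `H¹(O_F[1/p], T)`, file `EllipticZetaReciprocity`, reused — classes unramified outside `p`).
* §2 `layerCoresOver T κ n` (the trace map `H¹(K_{n+1}, T) → H¹(K_n, T)` along the layers of `κ : ZpExtension K p`; = the tree's
  `CM.layerCores` at the pair of layers, `layerCoresOver_eq_layerCores`), `IsNormCompatibleOver`, `normCompatibleOver`; `layerCoresOver_conjMap`.
* §3 **`IwasawaH1DataOver V p κ γ`** for a Weierstrass curve `V` over the field `K` (an elliptic curve over a number field in every use, e.g. `V = W.baseChange K`),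
  `T = T_pV` (the tree's `Kato2004.CM.tateRepK V p` = `V.tateGaloisRep p (V.continuous_galoisRepTate_holds p)`, defined for every elliptic curve over every field despite its namespace): abstract `Λ`-module `H` with `proj n : H → H¹(K_n, T_pV)` landing in
  `integralH1K`, compatible with the trace maps, jointly bijective onto the norm-compatible integral families,
  `X ∈ Λ` acting as `conj_γ − 1`, constants through the `ℤ_p`-structure of the levels; API `toFamily`, `proj_eq_iff`,
  `exists_unique_lift` (a norm-compatible integral family IS an element — how zeta / Heegner / elliptic-unit classes
  over `K` enter).
* §4 RIGIDITY (`proj_coe_smul`, `proj_smul`: `Λ` acts on level `n` through `Λ/(ω_n)`, `ω_n = (X+1)^{p^n} − 1`),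
  UNIQUENESS (`exists_linearEquiv`) and EXISTENCE
  (`nonempty_iwasawaH1DataOver`: the norm-compatible integral families with the levelwise `Λ/(ω_n)`-action by
  Weierstrass division — the construction of `IwasawaH1Exists.nonempty_iwasawaH1Data_holds`, generic algebra reused).

NOT here (next files of the lane): the Shapiro maps `res : 𝐇¹_Γ(T_pW) → 𝐇¹_{K,Γ}(T_pW_K)` / `cor` along
`Γ_K → Γ_ℚ` (to be built levelwise like `IwasawaH1Data.loc`, with `map_coresLe_eq_coresLe_map` and the inertia
dictionary `AbsIntegersEquiv.absGaloisRestrict_mem_inertia_comap`), the localisation `loc_w` at a place `w ∣ p`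
of `K` into a local carrier, `𝐇²`, Poitou–Tate; any fact about ranks / torsion (Kato Thm 12.4 is over `ℚ`).

## References

* K. Kato, Astérisque 295 (2004): §8.2 (pp. 180–181), Lemma 8.5 (pp. 183–184), §12.2 (12.2.1) (p. 220), §13.8
  (p. 228). [Kato2004Asterisque]
* B. Perrin-Riou, *Théorie d'Iwasawa des représentations p-adiques sur un corps local*, Invent. Math. 115 (1994),
  §1 (Iwasawa cohomology `Z^i_∞`). [PerrinRiou1994Invent]
* K. Rubin, *Euler Systems*, Ann. of Math. Stud. 147 (2000), App. B §2–§3 (continuous cohomology and inverse limits,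
  `H¹_∞(K, T) = lim← H¹(K_n, T)`). [Rubin2000]
* S. Lang, *Cyclotomic Fields I and II* (1990), Ch. 5 §1 Thm. 1.1 (`Λ ≅ lim← ℤ_p[X]/(ω_n)`). [Lang1990]
* Tree: `Kato2004/IwasawaCohomology.lean` (the `ℚ`-version and its design notes, READING of Lemma 8.5),
  `Kato2004/IwasawaCohomologyExistsProofs.lean` (generic Weierstrass-division algebra, reused),
  `Kato2004/EllipticZetaReciprocity.lean` (`tateRepK`), `GaloisRepresentations/ContinuousCorestrictionRelConj.lean`.
-/

noncomputable section

open scoped NumberField Pointwise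
open CategoryTheory Field IsDedekindDomain Polynomial
open Literature.NumberTheory.GaloisRepresentations
open Literature.NumberTheory.EllipticCurves (subgroupInclusion subgroupInclusion_apply_coe
  subgroupConj subgroupConj_apply_coe)
open Literature.NumberTheory.EllipticCurves.Kato2004.CM (tateRepK integralH1K mem_integralH1K_iff)

namespace Literature.NumberTheory.EllipticCurves.Kato2004

/-! ## §1 Lemma 8.5 over `K`: the integral classes `H¹(O_F[1/p], T) ↪ H¹(F, T)` -/

section Integral

variable {K : Type} [Field K]
  {A : Type} [CommRing A] [TopologicalSpace A] {M : Type} [AddCommGroup M] [Module A M]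
  [TopologicalSpace M] [IsTopologicalAddGroup M] [ContinuousSMul A M]

/-- **The `Γ_K`-action preserves the integral classes `H¹(O_F[1/p], T) = CM.integralH1K T p U`** (the tree's `K`-version
of Kato's `H¹(O_F[1/p], T)`, file `EllipticZetaReciprocity`; for `U ⊴ Γ_K` normal): `x ∈ H¹(O_F[1/p], T) ⟹ g · x ∈ H¹(O_F[1/p], T)` —
on cocycles, for `y ∈ U ∩ I_𝔓`, `(g·φ)(y) = g φ(g⁻¹ y g)` with `g⁻¹ y g ∈ U ∩ I_{g⁻¹𝔓}`; verbatim `IwasawaH1Exists.conjMap_mem_integralH1`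
with `ℚ ↦ K`. [cite: Kato2004Asterisque, §8.2 and Lemma 8.5 (pp. 180–184)] -/
theorem conjMap_mem_integralH1K (T : GaloisRep K A M) (p : ℕ)
    (U : Subgroup (absoluteGaloisGroup K)) [U.Normal] (g : absoluteGaloisGroup K)
    {x : H1 T U} (hx : x ∈ integralH1K T p U) :
    conjMap T.toTopRep U g 1 x ∈ integralH1K T p U := by
  rw [mem_integralH1K_iff] at hx ⊢
  intro v hv 𝔓 h𝔓
  obtain ⟨φ, rfl⟩ := oneCocycleClass_surjective _ x
  have h0 := hx v hv _ (smul_mem_primesAbove h𝔓 g⁻¹)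
  rw [resLe_oneCocycleClass, oneCocycleClass_eq_zero_iff] at h0
  obtain ⟨w, hw⟩ := h0
  rw [conjMap_oneCocycleClass, resLe_oneCocycleClass, oneCocycleClass_eq_zero_iff]
  refine ⟨T.toTopRep.ρ g w, fun y ↦ ?_⟩
  have hyI : (y : absoluteGaloisGroup K) ∈ 𝔓.inertia (absoluteGaloisGroup K) := y.2.2
  have hyU : (y : absoluteGaloisGroup K) ∈ U := y.2.1
  have hmemI : g⁻¹ * (y : absoluteGaloisGroup K) * g ∈
      (g⁻¹ • 𝔓).inertia (absoluteGaloisGroup K) := by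
    have := (Ideal.conj_mem_inertia_smul_iff 𝔓 g⁻¹ (y : absoluteGaloisGroup K)).mpr hyI
    simpa using this
  have hmemU : g⁻¹ * (y : absoluteGaloisGroup K) * g ∈ U :=
    Subgroup.Normal.conj_mem' inferInstance _ hyU g
  have key : φ.1 (subgroupInclusion inf_le_left
        ⟨g⁻¹ * (y : absoluteGaloisGroup K) * g, hmemU, hmemI⟩) =
      T.toTopRep.ρ (g⁻¹ * (y : absoluteGaloisGroup K) * g) w - w :=
    hw ⟨g⁻¹ * (y : absoluteGaloisGroup K) * g, hmemU, hmemI⟩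
  rw [contOneCocycles.pullback_apply, TopRep.hom_ofHom]
  change (contOneCocycles.pullback (subgroupConj U g) (conjRepHom T.toTopRep U g) φ).1
      (subgroupInclusion (inf_le_left : U ⊓ 𝔓.inertia (absoluteGaloisGroup K) ≤ U) y) = _
  rw [conj_pullback_apply]
  have harg : subgroupConj U g
      (subgroupInclusion (inf_le_left : U ⊓ 𝔓.inertia (absoluteGaloisGroup K) ≤ U) y) =
      subgroupInclusion inf_le_left ⟨g⁻¹ * (y : absoluteGaloisGroup K) * g, hmemU, hmemI⟩ :=
    Subtype.ext rfl
  rw [harg, key, map_sub, subgroupRep_ρ_apply, ← ρ_mul_apply,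
    show g * (g⁻¹ * (y : absoluteGaloisGroup K) * g) = (y : absoluteGaloisGroup K) * g by group,
    ρ_mul_apply]

end Integral

/-! ## §2 The trace maps along the layers of a `ℤ_p`-extension of `K` -/

section Layers

variable {K : Type} [Field K]
  {A : Type} [CommRing A] [TopologicalSpace A] {M : Type} [AddCommGroup M] [Module A M]
  [TopologicalSpace M] [IsTopologicalAddGroup M] [ContinuousSMul A M]
  (T : GaloisRep K A M) {p : ℕ} [Fact p.Prime] (κ : ZpExtension K p)

/-- The corestriction ("trace map") `Cor : H¹(K_{n+1}, T) → H¹(K_n, T)` between consecutive layers of the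
`ℤ_p`-extension `κ` of `K` (`κ.layerSubgroup (n+1) ≤ κ.layerSubgroup n`, open of finite index in the compact `Γ_K` — `absoluteGaloisGroup_compactSpace`, every field `K`),
packaged from the tree's relative corestriction `coresLe` exactly as `Kato2004.layerCores` is over `ℚ`.
[cite: Kato2004Asterisque, §12.2 (p. 220)] [cite: Rubin2000, App. B §3] -/
def layerCoresOver (n : ℕ) : H1 T (κ.layerSubgroup (n + 1)) →ₗ[A] H1 T (κ.layerSubgroup n) :=
  haveI : CompactSpace (absoluteGaloisGroup K) := absoluteGaloisGroup_compactSpace K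
  haveI : (κ.layerSubgroup (n + 1)).FiniteIndex :=
    finiteIndex_of_isOpen_of_compactSpace _ (κ.isOpen_layerSubgroup (n + 1))
  haveI : Fintype (κ.layerSubgroup n ⧸ (κ.layerSubgroup (n + 1)).subgroupOf (κ.layerSubgroup n)) :=
    Fintype.ofFinite _
  coresLe T.toTopRep (κ.layerSubgroup_antitone (Nat.le_succ n)) (κ.isOpen_layerSubgroup (n + 1))

/-- `layerCoresOver` is the relative corestriction `coresLe` for ANY finiteness structure on the quotient.
[cite: Kato2004Asterisque, §12.2 (p. 220)] -/
theorem layerCoresOver_eq_coresLe (n : ℕ)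
    [inst : Fintype (κ.layerSubgroup n ⧸ (κ.layerSubgroup (n + 1)).subgroupOf (κ.layerSubgroup n))]
    (y : H1 T (κ.layerSubgroup (n + 1))) :
    layerCoresOver T κ n y =
      coresLe T.toTopRep (κ.layerSubgroup_antitone (Nat.le_succ n)) (κ.isOpen_layerSubgroup (n + 1)) y := by
  haveI : CompactSpace (absoluteGaloisGroup K) := absoluteGaloisGroup_compactSpace K
  haveI hfi : (κ.layerSubgroup (n + 1)).FiniteIndex :=
    finiteIndex_of_isOpen_of_compactSpace _ (κ.isOpen_layerSubgroup (n + 1))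
  obtain rfl : inst = Fintype.ofFinite _ := Subsingleton.elim _ _
  rfl

/-- Bridge to the tree's `K`-side trace maps of `EllipticZetaReciprocity` (`CM.layerCores`, indexed by a pair of open subgroups):
`layerCoresOver T κ n` IS `CM.layerCores T (κ.layerSubgroup_antitone _) (κ.isOpen_layerSubgroup _)` (definitional).
[cite: Kato2004Asterisque, §12.2 (p. 220)] -/
theorem layerCoresOver_eq_layerCores [NumberField K] (n : ℕ) :
    layerCoresOver T κ n = CM.layerCores T (κ.layerSubgroup_antitone (Nat.le_succ n)) (κ.isOpen_layerSubgroup (n + 1)) :=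
  rfl

/-- The trace map commutes with the action of `Γ_K` (`coresLe_conjMap` for the normal layers).
[cite: Kato2004Asterisque, §12.2 (p. 220)] -/
theorem layerCoresOver_conjMap (n : ℕ) (g : absoluteGaloisGroup K) (y : H1 T (κ.layerSubgroup (n + 1))) :
    layerCoresOver T κ n (conjMap T.toTopRep (κ.layerSubgroup (n + 1)) g 1 y) =
      conjMap T.toTopRep (κ.layerSubgroup n) g 1 (layerCoresOver T κ n y) := by
  haveI : CompactSpace (absoluteGaloisGroup K) := absoluteGaloisGroup_compactSpace K
  letI : (κ.layerSubgroup (n + 1)).FiniteIndex :=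
    finiteIndex_of_isOpen_of_compactSpace _ (κ.isOpen_layerSubgroup (n + 1))
  letI : Fintype (κ.layerSubgroup n ⧸ (κ.layerSubgroup (n + 1)).subgroupOf (κ.layerSubgroup n)) :=
    Fintype.ofFinite _
  have h := coresLe_conjMap T.toTopRep (κ.layerSubgroup_antitone (Nat.le_succ n))
    (κ.isOpen_layerSubgroup (n + 1)) g y
  unfold layerCoresOver
  convert h using 2

/-- A family `y = (y_n)_n`, `y_n ∈ H¹(K_n, T)`, is a **norm-compatible integral family** along `κ`: every `y_n`
lies in `H¹(O_{K_n}[1/p], T)` and `Cor(y_{n+1}) = y_n` — an element of `lim←_n H¹(O_{K_n}[1/p], T)` written levelwise.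
[cite: Kato2004Asterisque, §12.2 (p. 220)] [cite: Rubin2000, App. B §3] -/
def IsNormCompatibleOver (y : ∀ n : ℕ, H1 T (κ.layerSubgroup n)) : Prop :=
  (∀ n, y n ∈ integralH1K T p (κ.layerSubgroup n)) ∧ ∀ n, layerCoresOver T κ n (y (n + 1)) = y n

/-- The norm-compatible integral families form an `A`-submodule of `∏_n H¹(K_n, T)`: the inverse limit
`lim←_n H¹(O_{K_n}[1/p], T)` written inside the product. [cite: Kato2004Asterisque, §12.2 (p. 220)] -/
def normCompatibleOver : Submodule A (∀ n : ℕ, H1 T (κ.layerSubgroup n)) where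
  carrier := {y | IsNormCompatibleOver T κ y}
  zero_mem' := ⟨fun n ↦ (integralH1K T p _).zero_mem, fun n ↦ by simp only [Pi.zero_apply, map_zero]⟩
  add_mem' := fun {y y'} hy hy' ↦
    ⟨fun n ↦ (integralH1K T p _).add_mem (hy.1 n) (hy'.1 n),
      fun n ↦ by simp only [Pi.add_apply, map_add, hy.2 n, hy'.2 n]⟩
  smul_mem' := fun a y hy ↦
    ⟨fun n ↦ (integralH1K T p _).smul_mem a (hy.1 n),
      fun n ↦ by simp only [Pi.smul_apply, map_smul, hy.2 n]⟩

/-- Membership in `normCompatibleOver` (unfolding). [cite: Kato2004Asterisque, §12.2 (p. 220)] -/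
@[simp] theorem mem_normCompatibleOver_iff (y : ∀ n : ℕ, H1 T (κ.layerSubgroup n)) :
    y ∈ normCompatibleOver T κ ↔ IsNormCompatibleOver T κ y :=
  Iff.rfl

end Layers

/-! ## §3 The pinned interface `𝐇¹_{K,Γ}(T_pV) = lim←_n H¹(O_{K_n}[1/p], T_pV)` for an elliptic curve `V/K` -/

section Generic

variable {K : Type} [Field K] {p : ℕ} [Fact p.Prime] (κ : ZpExtension K p)

/-- `γ^{pⁿ} ∈ Gal(K̄/K_n)` for a topological generator `γ` (local copy of `ZpExtension.pow_mem_layerSubgroup`). [folklore] -/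
private theorem pow_mem_layerSubgroup_over {γ : absoluteGaloisGroup K} (hγ : κ.IsTopGenerator γ) (n : ℕ) :
    γ ^ p ^ n ∈ κ.layerSubgroup n := by
  have hγ' : κ γ = Multiplicative.ofAdd 1 := hγ
  rw [ZpExtension.mem_layerSubgroup, map_pow, hγ', ← ofAdd_nsmul, toAdd_ofAdd, nsmul_eq_mul,
    mul_one, Nat.cast_pow]

/-- A linear map intertwining two endomorphisms intertwines the polynomials in them (local copy of the private
lemma of `IwasawaCohomologyExistsProofs`). [folklore] -/
private theorem map_aeval_apply_of_comp_eq_over {M M' : Type*} [AddCommGroup M] [Module ℤ_[p] M]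
    [AddCommGroup M'] [Module ℤ_[p] M']
    (g : M →ₗ[ℤ_[p]] M') (a : Module.End ℤ_[p] M) (b : Module.End ℤ_[p] M')
    (h : g ∘ₗ a = b ∘ₗ g) (r : ℤ_[p][X]) (m : M) : g (aeval a r m) = aeval b r (g m) := by
  induction r using Polynomial.induction_on generalizing m with
  | C c => simp
  | add f₁ f₂ h₁ h₂ => simp [h₁, h₂]
  | monomial k c hk =>
    have hc : ∀ m, g (a m) = b (g m) := fun m => by simpa using LinearMap.congr_fun h m
    rw [pow_succ, ← mul_assoc]
    conv_rhs => rw [map_mul, Module.End.mul_apply, aeval_X]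
    conv_lhs => rw [map_mul, Module.End.mul_apply, aeval_X]
    rw [hk, hc]

end Generic

section Interface

variable {K : Type} [Field K] (V : WeierstrassCurve K) (p : ℕ) [Fact p.Prime]
  [ContinuousSMul ℤ_[p] (V.tateModule p)] (κ : ZpExtension K p) (γ : absoluteGaloisGroup K)

/-- **`H¹_Iw(K_Σ/K, T_pV) = lim←_n H¹(O_{K_n}[1/p], T_pV)` for a Weierstrass curve `V` over a field `K` (intended: an elliptic curve over a number field), along
the layers of the `ℤ_p`-extension `κ`, as a `Λ = ℤ_p⟦X⟧`-module with `X = conj_γ − 1` — hypothesis structure, the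
`K`-analogue (verbatim) of `Kato2004.IwasawaH1Data`.**  Data: an abstract `Λ`-module `H` and additive maps
`proj n : H → H¹(K_n, T_pV)` (`K_n` = the fixed field of `κ.layerSubgroup n`, `T_pV` = `tateRepK V p`).  Axioms:
`proj_mem` (values in `H¹(O_{K_n}[1/p], T_pV) = integralH1K`), `cores_proj` (compatible with the trace maps),
`proj_injective` / `proj_surjective` (`(proj n)_n : H ≅ lim←_n H¹(O_{K_n}[1/p], T_pV)` as abelian groups),
`proj_T_smul` (`X ∈ Λ` acts as `conj_γ − 1`), `proj_C_smul` (constants act through the `ℤ_p`-structure of the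
levels).  Nothing hidden (`proj_smul`: the pin is rigid); nothing asserted; inhabited (`nonempty_iwasawaH1DataOver`).
[cite: Kato2004Asterisque, §8.2 and Lemma 8.5 (pp. 180–184), §12.2 (p. 220)] [cite: Rubin2000, App. B §2–§3] -/
structure IwasawaH1DataOver where
  /-- The underlying type of the Iwasawa cohomology module `𝐇¹_{K,Γ}(T_pV)`. -/
  H : Type
  /-- `𝐇¹` is an abelian group. -/
  [addCommGroup : AddCommGroup H]
  /-- `𝐇¹` is a `Λ = ℤ_p⟦X⟧`-module. -/
  [module : Module (IwasawaAlgebra p) H]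
  /-- The projection to the `n`-th layer `H¹(K_n, T_pV)`. -/
  proj : ∀ n : ℕ, H →+ H1 (tateRepK V p) (κ.layerSubgroup n)
  /-- The projections are integral classes: `proj n x ∈ H¹(O_{K_n}[1/p], T_pV)` (§8.2, Lemma 8.5). -/
  proj_mem : ∀ (n : ℕ) (x : H), proj n x ∈ integralH1K (tateRepK V p) p (κ.layerSubgroup n)
  /-- Compatibility with the trace maps `Cor : H¹(K_{n+1}, T) → H¹(K_n, T)`. -/
  cores_proj : ∀ (n : ℕ) (x : H), layerCoresOver (tateRepK V p) κ n (proj (n + 1) x) = proj n x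
  /-- `(proj n)_n` is injective. -/
  proj_injective : ∀ x : H, (∀ n, proj n x = 0) → x = 0
  /-- `(proj n)_n` is surjective onto the norm-compatible integral families (the inverse limit). -/
  proj_surjective : ∀ y : (∀ n : ℕ, H1 (tateRepK V p) (κ.layerSubgroup n)),
    IsNormCompatibleOver (tateRepK V p) κ y → ∃ x : H, ∀ n, proj n x = y n
  /-- `X` acts as `conj_γ − 1` on every layer. -/
  proj_T_smul : ∀ (n : ℕ) (x : H),
    proj n ((PowerSeries.X : IwasawaAlgebra p) • x) =
      conjMap (tateRepK V p).toTopRep (κ.layerSubgroup n) γ 1 (proj n x) - proj n x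
  /-- Constants `c ∈ ℤ_p` act through the `ℤ_p`-module structure of `H¹(K_n, T_pV)`. -/
  proj_C_smul : ∀ (c : ℤ_[p]) (n : ℕ) (x : H), proj n (PowerSeries.C c • x) = c • proj n x

attribute [instance] IwasawaH1DataOver.addCommGroup IwasawaH1DataOver.module

namespace IwasawaH1DataOver

variable {V p κ γ} (I : IwasawaH1DataOver V p κ γ)

/-- The family of projections `x ↦ (proj n x)_n : 𝐇¹ → ∏_n H¹(K_n, T_pV)`. [cite: Kato2004Asterisque, §12.2 (p. 220)] -/
def toFamily : I.H →+ (∀ n : ℕ, H1 (tateRepK V p) (κ.layerSubgroup n)) where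
  toFun x n := I.proj n x
  map_zero' := funext fun n ↦ map_zero (I.proj n)
  map_add' x y := funext fun n ↦ map_add (I.proj n) x y

/-- **Extensionality of `𝐇¹_{K,Γ}`**: two elements agree iff they have the same image in every layer
(`proj_injective`). [cite: Kato2004Asterisque, §12.2 (p. 220)] -/
theorem proj_eq_iff {x y : I.H} : (∀ n, I.proj n x = I.proj n y) ↔ x = y := by
  refine ⟨fun h ↦ ?_, fun h n ↦ by rw [h]⟩
  rw [← sub_eq_zero]
  exact I.proj_injective _ fun n ↦ by rw [map_sub, h n, sub_self]

/-- The image of `𝐇¹` in `∏_n H¹(K_n, T_pV)` consists of norm-compatible integral families.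
[cite: Kato2004Asterisque, §12.2 (p. 220)] -/
theorem isNormCompatibleOver_toFamily (x : I.H) : IsNormCompatibleOver (tateRepK V p) κ (I.toFamily x) :=
  ⟨fun n ↦ I.proj_mem n x, fun n ↦ I.cores_proj n x⟩

/-- The image of `𝐇¹` in `∏_n H¹(K_n, T_pV)` IS the set of norm-compatible integral families.
[cite: Kato2004Asterisque, §12.2 (p. 220)] -/
theorem range_toFamily :
    Set.range I.toFamily = {y | IsNormCompatibleOver (tateRepK V p) κ y} := by
  ext y
  constructor
  · rintro ⟨x, rfl⟩
    exact I.isNormCompatibleOver_toFamily x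
  · intro hy
    obtain ⟨x, hx⟩ := I.proj_surjective y hy
    exact ⟨x, funext hx⟩

/-- **The `Λ`-adic class of a norm-compatible family over `K`**: a norm-compatible family of integral classes
`(y_n)_n` (e.g. the layer components of an Euler system over `K` — Heegner classes, elliptic units, or the
restrictions of Kato's zeta classes) defines a UNIQUE `𝐳 ∈ 𝐇¹_{K,Γ}` with `proj n 𝐳 = y_n` for all `n`.
[cite: Rubin2000, App. B §2–§3] [cite: Kato2004Asterisque, §13.1 and Thm. 13.4 (pp. 224–226) (shape, over ℚ)] -/
theorem exists_unique_lift {y : ∀ n : ℕ, H1 (tateRepK V p) (κ.layerSubgroup n)}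
    (hy : IsNormCompatibleOver (tateRepK V p) κ y) : ∃! x : I.H, ∀ n, I.proj n x = y n := by
  obtain ⟨x, hx⟩ := I.proj_surjective y hy
  exact ⟨x, hx, fun x' hx' ↦ I.proj_eq_iff.mp fun n ↦ by rw [hx n, hx' n]⟩

/-! ## §4 Rigidity of the pin, uniqueness and existence -/

/-- **Polynomials act levelwise**: `proj n (r • x) = r(conj_γ − 1) (proj n x)` for `r ∈ ℤ_p[X]`
(from `proj_T_smul` and `proj_C_smul`). [cite: Kato2004Asterisque, §12.2 (p. 220)] -/
theorem proj_coe_smul (n : ℕ) (r : ℤ_[p][X]) (x : I.H) :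
    I.proj n ((r : PowerSeries ℤ_[p]) • x) =
      aeval ((conjMap (tateRepK V p).toTopRep (κ.layerSubgroup n) γ 1).hom.toLinearMap - 1) r
        (I.proj n x) := by
  induction r using Polynomial.induction_on generalizing x with
  | C c =>
    rw [Polynomial.coe_C, I.proj_C_smul, aeval_C, Module.algebraMap_end_apply]
  | add f₁ f₂ h₁ h₂ =>
    rw [Polynomial.coe_add, add_smul, map_add, h₁, h₂, map_add, LinearMap.add_apply]
  | monomial k c hk =>
    rw [pow_succ, ← mul_assoc, Polynomial.coe_mul, Polynomial.coe_X, mul_smul, hk, I.proj_T_smul]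
    conv_rhs => rw [map_mul, Module.End.mul_apply, aeval_X, LinearMap.sub_apply, Module.End.one_apply]
    rfl

/-- **The `Λ`-action of ANY datum is levelwise (the pin is rigid)**: for every power series `f` and every polynomial
`r ≡ f (mod ω_n)`, `proj n (f • x) = r(conj_γ − 1) (proj n x)` — `f = r + ω_n q` and `ω_n = (X+1)^{p^n} − 1` kills the `n`-th
layer because `γ^{p^n} ∈ Gal(K̄/K_n)` acts trivially on `H¹(K_n, T_pV)`. [cite: Lang1990, Ch. 5 §1 Thm. 1.1] -/
theorem proj_smul (hγ : κ.IsTopGenerator γ) (n : ℕ) {f : PowerSeries ℤ_[p]} {r : ℤ_[p][X]}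
    (hfr : f - (r : PowerSeries ℤ_[p]) ∈
      Ideal.span {(((X + 1 : ℤ_[p][X]) ^ p ^ n - 1 : ℤ_[p][X]) : PowerSeries ℤ_[p])})
    (x : I.H) :
    I.proj n (f • x) =
      aeval ((conjMap (tateRepK V p).toTopRep (κ.layerSubgroup n) γ 1).hom.toLinearMap - 1) r
        (I.proj n x) := by
  -- `ω_n` kills the `n`-th layer: `conj_γ^{p^n} = conj_{γ^{p^n}} = 1` on `H¹(K_n, T_pV)` (inner automorphisms)
  have homega : ∀ z : I.H,
      I.proj n ((((X + 1 : ℤ_[p][X]) ^ p ^ n - 1 : ℤ_[p][X]) : PowerSeries ℤ_[p]) • z) = 0 := fun z ↦ by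
    rw [proj_coe_smul]
    have hθ := conjMap_toLinearMap_pow_eq_one (tateRepK V p).toTopRep (κ.layerSubgroup n)
      (pow_mem_layerSubgroup_over κ hγ n)
    simp [map_sub, map_pow, map_add, aeval_X, sub_add_cancel, hθ]
  obtain ⟨q, hq⟩ := Ideal.mem_span_singleton'.mp hfr
  have hf : f = (r : PowerSeries ℤ_[p]) +
      (((X + 1 : ℤ_[p][X]) ^ p ^ n - 1 : ℤ_[p][X]) : PowerSeries ℤ_[p]) * q := by
    rw [mul_comm, hq, add_sub_cancel]
  rw [hf, add_smul, mul_smul, map_add, homega, add_zero, proj_coe_smul]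

variable (J : IwasawaH1DataOver V p κ γ)

/-- **Uniqueness of the pin**: any two data over `K` are isomorphic as `Λ`-modules by an isomorphism compatible, in both
directions, with all the projections `proj n` (both project bijectively onto the norm-compatible integral families, and
the `Λ`-actions are levelwise, `proj_smul`). [cite: Lang1990, Ch. 5 §1 Thm. 1.1] [cite: Kato2004Asterisque, §12.2 (p. 220)] -/
theorem exists_linearEquiv (hγ : κ.IsTopGenerator γ) :
    ∃ e : I.H ≃ₗ[IwasawaAlgebra p] J.H,
      (∀ (n : ℕ) (x : I.H), J.proj n (e x) = I.proj n x) ∧ ∀ (n : ℕ) (y : J.H), I.proj n (e.symm y) = J.proj n y := by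
  have hex : ∀ x : I.H, ∃ y : J.H, ∀ n, J.proj n y = I.proj n x := fun x ↦
    J.proj_surjective _ (I.isNormCompatibleOver_toFamily x)
  choose e he using hex
  have hadd : ∀ x x', e (x + x') = e x + e x' := fun x x' ↦
    J.proj_eq_iff.mp fun n ↦ by rw [he, map_add, map_add, he, he]
  have hsmul : ∀ (f : IwasawaAlgebra p) (x : I.H), e (f • x) = f • e x := fun f x ↦
    J.proj_eq_iff.mp fun n ↦ by
      obtain ⟨r, hr⟩ := IwasawaH1Exists.exists_polynomial_sub_coe_mem_span p n f
      rw [he, I.proj_smul hγ n hr, J.proj_smul hγ n hr, he]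
  let eₗ : I.H →ₗ[IwasawaAlgebra p] J.H :=
    { toFun := e, map_add' := hadd, map_smul' := hsmul }
  have hinj : Function.Injective eₗ := fun x x' h ↦
    I.proj_eq_iff.mp fun n ↦ by rw [← he x n, ← he x' n]; exact congrArg (J.proj n) h
  have hsurj : Function.Surjective eₗ := fun y ↦ by
    obtain ⟨x, hx⟩ := I.proj_surjective _ (J.isNormCompatibleOver_toFamily y)
    exact ⟨x, J.proj_eq_iff.mp fun n ↦ (he x n).trans (hx n)⟩
  refine ⟨LinearEquiv.ofBijective eₗ ⟨hinj, hsurj⟩, fun n x ↦ he x n, fun n y ↦ ?_⟩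
  have h := he ((LinearEquiv.ofBijective eₗ ⟨hinj, hsurj⟩).symm y) n
  rw [show e ((LinearEquiv.ofBijective eₗ ⟨hinj, hsurj⟩).symm y) =
      (LinearEquiv.ofBijective eₗ ⟨hinj, hsurj⟩) ((LinearEquiv.ofBijective eₗ ⟨hinj, hsurj⟩).symm y) from rfl,
    LinearEquiv.apply_symm_apply] at h
  exact h.symm

end IwasawaH1DataOver

/-- **EXISTENCE: `𝐇¹_{K,Γ}(T_pV)` is a `Λ`-module** — `IwasawaH1DataOver V p κ γ` is inhabited for every Weierstrass
curve `V` over a field `K` (no `NumberField`/`IsElliptic` hypothesis is needed for the construction), prime `p`, `ℤ_p`-extension `κ` of `K` and topological generator `γ`.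
Construction (verbatim `IwasawaH1Exists.nonempty_iwasawaH1Data_holds` with `ℚ ↦ K`): `H` = the norm-compatible
integral families, `proj n` = the `n`-th coordinate; `Λ` acts on the level `H¹(K_n, T_pV)` through
`Λ/(ω_n) ≅ ℤ_p[X]/(ω_n)` (Weierstrass division), `X ↦ conj_γ − 1`, well defined because `γ^{p^n} ∈ Gal(K̄/K_n)` acts
trivially; the levelwise actions commute with the trace maps (`layerCoresOver_conjMap`) and preserve integrality
(`conjMap_mem_integralH1K`).  No topology on the levels is used.
[cite: Kato2004Asterisque, §12.2 (12.2.1) (p. 220) and §13.8 (p. 228)] [cite: Lang1990, Ch. 5 §1 Thm. 1.1] -/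
theorem nonempty_iwasawaH1DataOver {γ : absoluteGaloisGroup K} (hγ : κ.IsTopGenerator γ) :
    Nonempty (IwasawaH1DataOver V p κ γ) := by
  -- the level operators `θ_n = conj_γ` on `H¹(K_n, T_pV)` and `θ_n^{p^n} = 1`
  let θ : ∀ n, Module.End ℤ_[p] (H1 (tateRepK V p) (κ.layerSubgroup n)) := fun n ↦
    (conjMap (tateRepK V p).toTopRep (κ.layerSubgroup n) γ 1).hom.toLinearMap
  have hθ : ∀ n (c : H1 (tateRepK V p) (κ.layerSubgroup n)),
      θ n c = conjMap (tateRepK V p).toTopRep (κ.layerSubgroup n) γ 1 c := fun _ _ ↦ rfl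
  have hθpow : ∀ n, θ n ^ p ^ n = 1 := fun n ↦
    conjMap_toLinearMap_pow_eq_one (tateRepK V p).toTopRep (κ.layerSubgroup n)
      (pow_mem_layerSubgroup_over κ hγ n)
  -- the `Λ`-action on each level through `Λ/(ω_n) ≅ ℤ_p[X]/(ω_n)`
  choose ψ hψ using fun n ↦ IwasawaH1Exists.exists_ringHom_of_pow_eq_one p (θ n) n (hθpow n)
  letI inst : ∀ n, Module (IwasawaAlgebra p) (H1 (tateRepK V p) (κ.layerSubgroup n)) :=
    fun n ↦ Module.compHom _ (ψ n)
  have smul_def : ∀ (n : ℕ) (f : IwasawaAlgebra p) (m : H1 (tateRepK V p) (κ.layerSubgroup n)),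
      f • m = ψ n f m := fun _ _ _ ↦ rfl
  have hψcoe : ∀ (n : ℕ) (r : ℤ_[p][X]), ψ n (r : PowerSeries ℤ_[p]) = aeval (θ n - 1) r :=
    fun n r ↦ hψ n _ r (by rw [sub_self]; exact Submodule.zero_mem _)
  have hψX : ∀ n, ψ n (PowerSeries.X : IwasawaAlgebra p) = θ n - 1 := fun n ↦ by
    rw [← Polynomial.coe_X, hψcoe, aeval_X]
  have hψC : ∀ (n : ℕ) (c : ℤ_[p]), ψ n (PowerSeries.C c : IwasawaAlgebra p) =
      algebraMap ℤ_[p] _ c := fun n c ↦ by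
    rw [← Polynomial.coe_C, hψcoe, aeval_C]
  -- `integralH1K` is stable under `θ_n - 1`
  have hstable : ∀ n, integralH1K (tateRepK V p) p (κ.layerSubgroup n) ≤
      (integralH1K (tateRepK V p) p (κ.layerSubgroup n)).comap (θ n - 1) := by
    intro n m hm
    rw [Submodule.mem_comap, LinearMap.sub_apply, Module.End.one_apply, hθ]
    exact Submodule.sub_mem _ (conjMap_mem_integralH1K (tateRepK V p) p _ γ hm) hm
  -- compatibility of `θ_n − 1` with the trace maps
  have hcomm : ∀ n, (layerCoresOver (tateRepK V p) κ n) ∘ₗ (θ (n + 1) - 1) =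
      (θ n - 1) ∘ₗ (layerCoresOver (tateRepK V p) κ n) := by
    intro n
    refine LinearMap.ext fun y ↦ ?_
    simp only [LinearMap.coe_comp, Function.comp_apply, LinearMap.sub_apply, Module.End.one_apply,
      map_sub, hθ, layerCoresOver_conjMap]
  -- the `Λ`-submodule of norm-compatible integral families
  let N : Submodule (IwasawaAlgebra p) (∀ n : ℕ, H1 (tateRepK V p) (κ.layerSubgroup n)) :=
    { carrier := {y | IsNormCompatibleOver (tateRepK V p) κ y}
      zero_mem' := (normCompatibleOver (tateRepK V p) κ).zero_mem
      add_mem' := fun ha hb ↦ (normCompatibleOver (tateRepK V p) κ).add_mem ha hb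
      smul_mem' := fun f y hy ↦ by
        refine ⟨fun n ↦ ?_, fun n ↦ ?_⟩
        · obtain ⟨r, hr⟩ := IwasawaH1Exists.exists_polynomial_sub_coe_mem_span p n f
          rw [Pi.smul_apply, smul_def, hψ n f r hr]
          exact aeval_apply_smul_mem_of_le_comap (hy.1 n) r _ (hstable n)
        · obtain ⟨r, hr⟩ := IwasawaH1Exists.exists_polynomial_sub_coe_mem_span p (n + 1) f
          rw [Pi.smul_apply, Pi.smul_apply, smul_def, smul_def, hψ (n + 1) f r hr,
            hψ n f r (IwasawaH1Exists.span_omega_succ_le p n hr),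
            map_aeval_apply_of_comp_eq_over _ _ _ (hcomm n), hy.2 n] }
  refine ⟨{
    H := N
    proj := fun n ↦
      { toFun := fun x ↦ (x : ∀ n : ℕ, H1 (tateRepK V p) (κ.layerSubgroup n)) n
        map_zero' := rfl
        map_add' := fun _ _ ↦ rfl }
    proj_mem := fun n x ↦ x.2.1 n
    cores_proj := fun n x ↦ x.2.2 n
    proj_injective := fun x hx ↦ Subtype.ext (funext hx)
    proj_surjective := fun y hy ↦ ⟨⟨y, hy⟩, fun _ ↦ rfl⟩
    proj_T_smul := fun n x ↦ ?_
    proj_C_smul := fun c n x ↦ ?_ }⟩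
  · change ψ n PowerSeries.X ((x : ∀ n : ℕ, H1 (tateRepK V p) (κ.layerSubgroup n)) n) = _
    rw [hψX, LinearMap.sub_apply, Module.End.one_apply, hθ]
    rfl
  · change ψ n (PowerSeries.C c) ((x : ∀ n : ℕ, H1 (tateRepK V p) (κ.layerSubgroup n)) n) = _
    rw [hψC, Module.algebraMap_end_apply]
    rfl

/-- For EVERY `ℤ_p`-extension `κ` of `K` the datum exists for some topological generator (one exists since
`κ : Γ_K → ℤ_p` is onto). [cite: Kato2004Asterisque, §12.2 (12.2.1) (p. 220)] -/
theorem exists_iwasawaH1DataOver :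
    ∃ (γ : absoluteGaloisGroup K) (_ : κ.IsTopGenerator γ), Nonempty (IwasawaH1DataOver V p κ γ) :=
  have ⟨γ, hγ⟩ : ∃ γ : absoluteGaloisGroup K, κ.IsTopGenerator γ := κ.surjective (Multiplicative.ofAdd 1)
  ⟨γ, hγ, nonempty_iwasawaH1DataOver V p κ hγ⟩

end Interface

end Literature.NumberTheory.EllipticCurves.Kato2004

end
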